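/-
COR-CM (cell pub-hodgecm2, stage 2 of the Hodge ladder) — item (vi) S2 «along» lane, WORLD-FREE FORM of the Thm-4.18 input (W1 of the
hM-side recipe, HOME/INBOX 2026-08-24 prove-7 g1; referee preference d2bridge-ref G33 §5, cite-1 DELTA 93∕95a, pin-2 gen 18):
the junction ✔ `Model.faceSupply_of_thm418AsPrinted_pinned_isog_along` (`Item6PinMatchAlong.lean`) consumes [Liu2021, Thm. 4.18] AS PRINTED at
exactly one point — ✔ `Thm418Invariants.exists_homK_ne_zero_of_irreducible_smooth` ⟹ «`Hom_E(A_K, A_μ)_ℚ ≠ 0` for small `K`».  This file states the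
SAME junction with that CONSEQUENCE as the hypothesis (`hHom`) in place of `hLiu ∕ hChi ∕ hirr ∕ hsm`: a statement true at the tree's datum in EITHER
pairing of Thm. 4.18 (tail `A_μ` fixed; the ω-side enters only as non-vanishing), hence displayable without naming a world.  Seat
prover-pub-hodgecm2-d2bridge-prove-7-g1-0.  ONE THEOREM (kernel lane), proof = the landed one minus the `exists_homK_ne_zero…` call; nothing landed is
edited or restated.  FRAMING: HC_CM is NOT proved; `hHom ∕ hCMisogσ ∕ hReach` are not inhabited here.
-/
import Summits.HodgeConjecture.CorCM.B01.Transposition.Item6PinMatchAlong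
import HarnessLib

/-!
# Item (vi) S2 along `σ`, world-free input: `FaceSupply` from «`Hom_E(A_K, A_μ)_ℚ ≠ 0` for small `K`»

[Liu2021] Y. Liu, *Fourier–Jacobi cycles and arithmetic relative trace formula*, Camb. J. Math. **9** (2021) = arXiv:2102.11518:
Thm. 4.18 (1) (FJcycle.tex l. 2239) «`Ω(μ)^K ≅ Hom_E(A_K, A_μ)_ℚ` for every sufficiently small `K`», Rem. 4.17 (l. 2226–2228), and the
non-vanishing of `Ω(μ) ⊗ ℂ ≅ ⊕ ω(μ, ε, χ)` (Thm. 4.18 main clause with App. D Lem. D.1 (1)) give, for every object `D_μ ∈ 𝒜(μ)`: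
«`Hom_E(A_K, A_{D_μ})_ℚ ≠ 0` for all sufficiently small open compact `K`» — the tree's ✔ `Thm418Invariants.exists_homK_ne_zero_of_irreducible_smooth`.
`faceSupply_of_homNeZero_pinned_isog_along` = ✔ `faceSupply_of_thm418AsPrinted_pinned_isog_along` with this consequence as the binder `hHom`
(the binders `hObj ∕ hμσ ∕ hCMisogσ ∕ hReach` unchanged).  The upward propagation through `Item6SupplyPinnedAssemblyAlong*` ∕ `PortJoin/HMDischargeLocal`
is the lane owners' (recipe in HOME/INBOX).  HC_CM is NOT proved.
-/

noncomputable section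

open scoped TensorProduct InnerProductSpace

namespace Summit.HodgeConjecture.CorCM.Model

open CategoryTheory AlgebraicGeometry NumberField
open Literature.AlgebraicGeometry.Motives
open Literature.AlgebraicGeometry.HodgeTheory
open Literature.AlgebraicGeometry.ComplexMultiplication (IsCMTypeRealisation)
open Literature.NumberTheory.ComplexMultiplication
open Literature.NumberTheory.Automorphic
open Literature.NumberTheory.Automorphic.IdeleClassGroup
open Literature.NumberTheory.Automorphic.PicardCM
open Literature.NumberTheory.Automorphic.Liu2021

/-- **B01-S at a consumer's pin read ALONG `σ`, from the PRINTED CONSEQUENCE «`Hom_E(A_K, A_μ)_ℚ ≠ 0` for small `K`»** (world-free twin of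
✔ `faceSupply_of_thm418AsPrinted_pinned_isog_along`: the binders `hLiu ∕ hChi ∕ hirr ∕ hsm` — consumed there only through
✔ `Thm418Invariants.exists_homK_ne_zero_of_irreducible_smooth` — are replaced by that lemma's conclusion `hHom`; everything else verbatim).
HC_CM is NOT proved; `hHom`, `hCMisogσ`, `hReach` are not inhabited here.
[cite: Liu2021, Thm. 4.18 (1) (FJcycle.tex l. 2239), Rem. 4.17 (l. 2226–2228), Def. 4.5 (2) (l. 1944–1951), Rem. 4.4 (l. 1930–1932), Def. 4.3 (2) (l. 1919)]
[cite: Shimura1998, §6.2 Theorem 3 and §8.3 Prop. 28] [cite: MumfordAV1970, §19 Remark p. 169] -/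
theorem faceSupply_of_homNeZero_pinned_isog_along
    (hHD : exists_isReal_hodgeModel) (hI : hodgePQ_independent_of_hodgeModel)
    (h₁ : BallQuotientUniformised) (h₃ : CMAbelianVarietyRealised)
    (D : ∀ (F : CMField) (ι₁ : F →+* ℂ) (_ : HermSpace3 F ι₁) (_ : CMType F), Thm418Data (maximalRealSubfield F) F)
    (σ : ∀ (F : CMField) (ι₁ : F →+* ℂ) (_ : HermSpace3 F ι₁) (_ : CMType F), F →+* ℂ)
    (Aμ : ∀ (F : CMField) (ι₁ : F →+* ℂ) (V : HermSpace3 F ι₁) (Φ : CMType F), (D F ι₁ V Φ).Obj → AbelianVariety ℂ)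
    -- [Liu2021, Thm. 4.18 (1) + Rem. 4.17 + «Ω(μ) ≠ 0»] — the printed CONSEQUENCE the lane consumes, pairing-free:
    -- for every object `D_μ` of the datum, `Hom_E(A_K, A_{D_μ})_ℚ ≠ 0` for all sufficiently small open compact `K`
    (hHom : ∀ (F : CMField), IsGalois ℚ F → 6 ≤ Module.finrank ℚ F → ∀ (Φ : CMType F) (ι₁ : F →+* ℂ), ι₁ ∈ Φ.1 →
      ∀ (V : HermSpace3 F ι₁) (Dμ : (D F ι₁ V Φ).Obj), ∃ K₀ : Subgroup (D F ι₁ V Φ).G, IsOpenCompact K₀ ∧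
        ∀ K : Subgroup (D F ι₁ V Φ).G, IsOpenCompact K → K ≤ K₀ → ∃ φ : (D F ι₁ V Φ).HomK K Dμ, φ ≠ 0)
    (hObj : ∀ (F : CMField), IsGalois ℚ F → 6 ≤ Module.finrank ℚ F → ∀ (Φ : CMType F) (ι₁ : F →+* ℂ), ι₁ ∈ Φ.1 →
      ∀ V : HermSpace3 F ι₁, Nonempty (D F ι₁ V Φ).Obj)
    (hμσ : ∀ (F : CMField), IsGalois ℚ F → 6 ≤ Module.finrank ℚ F → ∀ (Φ : CMType F) (ι₁ : F →+* ℂ), ι₁ ∈ Φ.1 →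
      ∀ (V : HermSpace3 F ι₁) (g : F ≃ₐ[ℚ] F),
        (σ F ι₁ V Φ).comp (g : F →+* F) ∈ (D F ι₁ V Φ).cmType.1 ↔ (σ F ι₁ V Φ).comp (g.symm : F →+* F) ∈ Φ.1)
    (hCMisogσ : ∀ (F : CMField) [IsGalois ℚ F], 6 ≤ Module.finrank ℚ F → ∀ (Φ : CMType F) (ι₁ : F →+* ℂ), ι₁ ∈ Φ.1 →
      ∀ (V : HermSpace3 F ι₁) (Dμ : (D F ι₁ V Φ).Obj),
        haveI := (D F ι₁ V Φ).isConjugateSymplectic.numberField_muAlgValueField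
        ∀ e : reflexField ℚ F (algValuedIn (σ F ι₁ V Φ) (D F ι₁ V Φ).cmType.1) →+* muAlgValueField F (D F ι₁ V Φ).μ,
          (∀ k : reflexField ℚ F (algValuedIn (σ F ι₁ V Φ) (D F ι₁ V Φ).cmType.1),
            ((e k : muAlgValueField F (D F ι₁ V Φ).μ) : ℂ) = σ F ι₁ V Φ k) →
          ∃ (B : AbelianVariety ℂ) (g : Aμ F ι₁ V Φ Dμ ⟶ B), AbelianVariety.IsIsogeny g ∧
            ∃ (ιB : 𝓞 (muAlgValueField F (D F ι₁ V Φ).μ) →+* End B)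
              (θB : muAlgValueField F (D F ι₁ V Φ).μ →+* Module.End ℂ (complexBetti B.X 1)),
              IsCMTypeRealisation (inducedCMType e (reflexCMType (σ F ι₁ V Φ) (D F ι₁ V Φ).cmType (AlgHom.id ℚ F))) B ιB θB)
    (hReach : ∀ (F : CMField), IsGalois ℚ F → 6 ≤ Module.finrank ℚ F → ∀ (Φ : CMType F) (ι₁ : F →+* ℂ), ι₁ ∈ Φ.1 →
      ∀ V : HermSpace3 F ι₁, ∃ Ksm : Subgroup (D F ι₁ V Φ).G, IsOpenCompact Ksm ∧
        ∀ (K : Subgroup (D F ι₁ V Φ).G) (Dμ : (D F ι₁ V Φ).Obj) (φ : (D F ι₁ V Φ).HomK K Dμ),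
          IsOpenCompact K → K ≤ Ksm → φ ≠ 0 →
            ∃ (Γ : Level V) (𝒥 : Jacobian (Var.scheme (ballQuotientUniformisedDatum_of h₁) h₃ (.pms (pmsCode F ι₁ V Γ))))
              (w : 𝒥.J ⟶ Aμ F ι₁ V Φ Dμ), w ≠ 0) :
    (picardCMUniverse hHD hI h₁ h₃).FaceSupply := by
  refine faceSupply_of_albaneseFactor hHD hI h₁ h₃ fun F hG h6 Φ ι₁ hι V => ?_
  haveI := hG
  haveI := (D F ι₁ V Φ).isConjugateSymplectic.numberField_muAlgValueField
  haveI := (D F ι₁ V Φ).isConjugateSymplectic.isCMField_muAlgValueField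
  obtain ⟨Dμ⟩ := hObj F hG h6 Φ ι₁ hι V
  obtain ⟨e, he⟩ := exists_ringHom_reflexField_muAlgValueField F (σ F ι₁ V Φ) (D F ι₁ V Φ).cmType
    (D F ι₁ V Φ).isConjugateSymplectic (D F ι₁ V Φ).isConjugateSymplectic.hasCMType_cmType
  obtain ⟨Ksm, hKsm, hreach⟩ := hReach F hG h6 Φ ι₁ hι V
  obtain ⟨K₀, hK₀, hK⟩ := hHom F hG h6 Φ ι₁ hι V Dμ
  have hKK : IsOpenCompact (K₀ ⊓ Ksm) := by
    refine ⟨?_, ?_⟩ <;> rw [Subgroup.coe_inf]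
    · exact hK₀.1.inter hKsm.1
    · exact hK₀.2.inter_right (Subgroup.isClosed_of_isOpen Ksm hKsm.1)
  obtain ⟨φ, hφ⟩ := hK (K₀ ⊓ Ksm) hKK inf_le_left
  obtain ⟨Γ, 𝒥, w, hw⟩ := hreach (K₀ ⊓ Ksm) Dμ φ hKK inf_le_right hφ
  obtain ⟨B, g, hg, ιB, θB, hB⟩ := hCMisogσ F h6 Φ ι₁ hι V Dμ e he
  exact ⟨Γ, 𝒥, exists_hom_cmAV_ne_zero_of_isInverse_reflex h₃ F (σ F ι₁ V Φ) (hμσ F hG h6 Φ ι₁ hι V) e hB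
    (CMReach.comp_ne_zero_of_isIsogeny hg hw)⟩


end Summit.HodgeConjecture.CorCM.Model

end
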